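import Mathlib
import Literature.Combinatorics.SimpleGraph.RamseyNumbers

/-!
# DRC step for the Prömel–Rödl core (crux `stmt-PneNP-9816`, line `box-dag-self-gadget-lifting`)

Helper file for the crux `Summit.PneNP.PneNP.Theses.RamseyUncertifiable.ResolutionUncertainty`
(`stmt-PneNP-9816`), line `box-dag-self-gadget-lifting`, stub `stub_drcStep`.

The statement `stub_drcStep` is a finite "dependent random choice" step with NON-neighbourhoods:
if `H` on `Fin n` has no clique of size `⌈2 log₂ n⌉`, `A` has at least `√n` vertices and every
vertex of `A` has at most `δ |B|` neighbours in `B`, then `A` contains an independent set `J` of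
size `≥ log₂ n / 40` whose common non-neighbourhood inside `B` has size `≥ |B| n^{-κ}`.

Proof (elementary averaging, no probability): average over all `h`-tuples `t ∈ B^h` the number of
vertices of `A` non-adjacent to every `t i` (double counting, `sum_card_filter_forall`) and the
number of "bad" `a`-subsets of that set (those with few common non-neighbours in `B`,
`sum_card_filter_subset`); some tuple has many vertices and few bad sets (`exists_good_subset`);
delete one vertex from each bad set (`exists_subset_forall_not_subset`); in the remaining set
Erdős–Szekeres (`Literature.Combinatorics.SimpleGraph.exists_clique_or_indep_of_choose_le_card`)
together with clique-freeness produces the independent set. The numerical side conditions are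
discharged for `n ≥ 2 ^ 60` with the explicit constants `δ = min κ 1 / 4`, `a = ⌈log₂ n / 40⌉`,
`h = ⌈a / min κ 1⌉`.
-/

namespace Summit.PneNP.PneNP.Theorems.RamseyUncertifiableResolutionUncertainty

open Finset

/-! ## Double counting over tuples -/

/-- Tuples all of whose coordinates satisfy `p` are exactly the tuples over the filtered set. -/
theorem filter_piFinset_forall {α : Type*} [DecidableEq α] (h : ℕ) (B : Finset α) (p : α → Prop)
    [DecidablePred p] :
    (Fintype.piFinset fun _ : Fin h => B).filter (fun t => ∀ i, p (t i)) =
      Fintype.piFinset fun _ : Fin h => B.filter p := by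
  ext t
  simp only [Finset.mem_filter, Fintype.mem_piFinset]
  exact ⟨fun h12 i => ⟨h12.1 i, h12.2 i⟩, fun h12 => ⟨fun i => (h12 i).1, fun i => (h12 i).2⟩⟩

/-- Double counting: summing over all `h`-tuples `t` from `B` the number of `v ∈ A` related to every
coordinate of `t` gives `∑_{v ∈ A} |{b ∈ B | R v b}| ^ h`. -/
theorem sum_card_filter_forall {α : Type*} [DecidableEq α] (h : ℕ) (A B : Finset α)
    (R : α → α → Prop) [∀ v b, Decidable (R v b)] :
    ∑ t ∈ Fintype.piFinset (fun _ : Fin h => B), (A.filter fun v => ∀ i, R v (t i)).card =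
      ∑ v ∈ A, (B.filter fun b => R v b).card ^ h := by
  calc ∑ t ∈ Fintype.piFinset (fun _ : Fin h => B), (A.filter fun v => ∀ i, R v (t i)).card
      = ∑ t ∈ Fintype.piFinset (fun _ : Fin h => B), ∑ v ∈ A, (if (∀ i, R v (t i)) then 1 else 0) :=
        Finset.sum_congr rfl fun t _ => Finset.card_filter _ _
    _ = ∑ v ∈ A, ∑ t ∈ Fintype.piFinset (fun _ : Fin h => B), (if (∀ i, R v (t i)) then 1 else 0) :=
        Finset.sum_comm
    _ = ∑ v ∈ A, (B.filter fun b => R v b).card ^ h := by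
        refine Finset.sum_congr rfl fun v _ => ?_
        rw [Finset.sum_boole, Nat.cast_id, filter_piFinset_forall h B (R v),
          Fintype.card_piFinset_const]

/-- Double counting for a family `𝒴` of subsets of `A`: summing over all `h`-tuples `t` from `B`
the number of members of `𝒴` inside `{v ∈ A | ∀ i, R v (t i)}` gives
`∑_{Y ∈ 𝒴} |{b ∈ B | ∀ v ∈ Y, R v b}| ^ h`. -/
theorem sum_card_filter_subset {α : Type*} [DecidableEq α] (h : ℕ) (A B : Finset α)
    (R : α → α → Prop) [∀ v b, Decidable (R v b)] (𝒴 : Finset (Finset α))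
    (h𝒴 : ∀ Y ∈ 𝒴, Y ⊆ A) :
    ∑ t ∈ Fintype.piFinset (fun _ : Fin h => B),
        (𝒴.filter fun Y => Y ⊆ A.filter fun v => ∀ i, R v (t i)).card =
      ∑ Y ∈ 𝒴, (B.filter fun b => ∀ v ∈ Y, R v b).card ^ h := by
  calc ∑ t ∈ Fintype.piFinset (fun _ : Fin h => B),
        (𝒴.filter fun Y => Y ⊆ A.filter fun v => ∀ i, R v (t i)).card
      = ∑ t ∈ Fintype.piFinset (fun _ : Fin h => B), ∑ Y ∈ 𝒴,
          (if (Y ⊆ A.filter fun v => ∀ i, R v (t i)) then 1 else 0) :=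
        Finset.sum_congr rfl fun t _ => Finset.card_filter _ _
    _ = ∑ Y ∈ 𝒴, ∑ t ∈ Fintype.piFinset (fun _ : Fin h => B),
          (if (Y ⊆ A.filter fun v => ∀ i, R v (t i)) then 1 else 0) := Finset.sum_comm
    _ = ∑ Y ∈ 𝒴, (B.filter fun b => ∀ v ∈ Y, R v b).card ^ h := by
        refine Finset.sum_congr rfl fun Y hY => ?_
        rw [Finset.sum_boole, Nat.cast_id, ← Fintype.card_piFinset_const,
          ← filter_piFinset_forall]
        congr 1
        ext t
        simp only [Finset.mem_filter, Fintype.mem_piFinset, Finset.subset_iff]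
        constructor
        · rintro ⟨hB, hsub⟩
          exact ⟨hB, fun i v hv => (hsub hv).2 i⟩
        · rintro ⟨hB, hall⟩
          exact ⟨hB, fun v hv => ⟨h𝒴 Y hY hv, fun i => hall i v hv⟩⟩

/-! ## Deletion -/

/-- One can destroy every member of a family `𝒴` of nonempty sets inside `S` by deleting at most
`|𝒴|` elements of `S`. -/
theorem exists_subset_forall_not_subset {α : Type*} [DecidableEq α] (S : Finset α)
    (𝒴 : Finset (Finset α)) (h𝒴 : ∀ Y ∈ 𝒴, Y.Nonempty) :
    ∃ S' ⊆ S, S.card ≤ S'.card + 𝒴.card ∧ ∀ Y ∈ 𝒴, ¬ Y ⊆ S' := by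
  induction 𝒴 using Finset.induction_on with
  | empty => exact ⟨S, Subset.rfl, by simp, by simp⟩
  | insert Y 𝒴 hY ih =>
    obtain ⟨S', hS'S, hcard, hnot⟩ := ih fun Z hZ => h𝒴 Z (mem_insert_of_mem hZ)
    obtain ⟨y, hy⟩ := h𝒴 Y (mem_insert_self _ _)
    refine ⟨S'.erase y, (erase_subset _ _).trans hS'S, ?_, ?_⟩
    · rw [card_insert_of_notMem hY]
      have := pred_card_le_card_erase (s := S') (a := y)
      omega
    · intro Z hZ
      rcases mem_insert.mp hZ with rfl | hZ
      · exact fun hsub => by simpa using hsub hy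
      · exact fun hsub => hnot Z hZ (hsub.trans (erase_subset _ _))

/-! ## The averaging step -/

/-- **Dependent random choice with non-neighbourhoods, counting form.** If every `v ∈ A` is related
to at least `(1 - δ)|B|` elements of the nonempty set `B`, then for all `h, a ≥ 1, θ ≥ 0` there is
`A₄ ⊆ A` with `|A₄| ≥ |A|(1-δ)^h - C(|A|, a) θ^h` such that every `a`-subset `Y ⊆ A₄` has at least
`|B| θ` elements of `B` related to all of `Y`.  (Average over `t ∈ B^h` the set
`{v ∈ A | ∀ i, R v (t i)}` minus its bad `a`-subsets, then delete a vertex from each bad subset.) -/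
theorem exists_good_subset {α : Type*} [DecidableEq α] (A B : Finset α) (R : α → α → Prop)
    [∀ v b, Decidable (R v b)] (h a : ℕ) (ha : 1 ≤ a) (δ θ : ℝ) (hδ : δ ≤ 1) (hθ : 0 ≤ θ)
    (hB : B.Nonempty) (hdeg : ∀ v ∈ A, (1 - δ) * B.card ≤ ((B.filter fun b => R v b).card : ℝ)) :
    ∃ A₄ ⊆ A, (A.card : ℝ) * (1 - δ) ^ h - (A.card.choose a : ℝ) * θ ^ h ≤ A₄.card ∧
      ∀ Y ⊆ A₄, Y.card = a → (B.card : ℝ) * θ ≤ (B.filter fun b => ∀ v ∈ Y, R v b).card := by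
  set T := Fintype.piFinset fun _ : Fin h => B with hT
  set 𝒴 := (A.powersetCard a).filter
      (fun Y => ((B.filter fun b => ∀ v ∈ Y, R v b).card : ℝ) < B.card * θ) with h𝒴
  have h𝒴A : ∀ Y ∈ 𝒴, Y ⊆ A := fun Y hY => (mem_powersetCard.mp (mem_filter.mp hY).1).1
  have hTne : T.Nonempty := hB.piFinset_const
  have hTcard : (T.card : ℝ) = (B.card : ℝ) ^ h := by
    rw [hT, Fintype.card_piFinset_const, Nat.cast_pow]
  -- lower bound for the first sum
  have h1 : (T.card : ℝ) * (A.card * (1 - δ) ^ h) ≤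
      ∑ t ∈ T, ((A.filter fun v => ∀ i, R v (t i)).card : ℝ) := by
    rw [← Nat.cast_sum, sum_card_filter_forall, Nat.cast_sum, hTcard]
    calc (B.card : ℝ) ^ h * (A.card * (1 - δ) ^ h) = ∑ _v ∈ A, ((1 - δ) * B.card) ^ h := by
          rw [Finset.sum_const, nsmul_eq_mul, mul_pow]; ring
      _ ≤ ∑ v ∈ A, ((B.filter fun b => R v b).card : ℝ) ^ h := by
          refine Finset.sum_le_sum fun v hv => ?_
          have h0 : 0 ≤ (1 - δ) * B.card := mul_nonneg (by linarith) (Nat.cast_nonneg _)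
          exact pow_le_pow_left₀ h0 (hdeg v hv) h
      _ = _ := by push_cast; rfl
  -- upper bound for the bad sum
  have h2 : ∑ t ∈ T, ((𝒴.filter fun Y => Y ⊆ A.filter fun v => ∀ i, R v (t i)).card : ℝ) ≤
      T.card * ((A.card.choose a : ℝ) * θ ^ h) := by
    rw [← Nat.cast_sum, sum_card_filter_subset h A B R 𝒴 h𝒴A, Nat.cast_sum, hTcard]
    calc ∑ Y ∈ 𝒴, (((B.filter fun b => ∀ v ∈ Y, R v b).card ^ h : ℕ) : ℝ)
        ≤ ∑ _Y ∈ 𝒴, ((B.card : ℝ) * θ) ^ h := by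
          refine Finset.sum_le_sum fun Y hY => ?_
          rw [Nat.cast_pow]
          exact pow_le_pow_left₀ (Nat.cast_nonneg _) (le_of_lt (mem_filter.mp hY).2) h
      _ = 𝒴.card * ((B.card : ℝ) * θ) ^ h := by rw [Finset.sum_const, nsmul_eq_mul]
      _ ≤ (A.card.choose a : ℝ) * ((B.card : ℝ) * θ) ^ h := by
          gcongr
          exact_mod_cast (card_filter_le _ _).trans (card_powersetCard a A).le
      _ = _ := by ring
  -- averaging
  obtain ⟨t, -, ht⟩ : ∃ t ∈ T, (A.card : ℝ) * (1 - δ) ^ h - (A.card.choose a : ℝ) * θ ^ h ≤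
      ((A.filter fun v => ∀ i, R v (t i)).card : ℝ) -
        ((𝒴.filter fun Y => Y ⊆ A.filter fun v => ∀ i, R v (t i)).card : ℝ) :=
    Finset.exists_le_of_sum_le hTne
      (by rw [Finset.sum_const, nsmul_eq_mul, Finset.sum_sub_distrib]; linarith [h1, h2])
  -- deletion
  obtain ⟨A₄, hA₄, hcard, hnot⟩ := exists_subset_forall_not_subset
    (A.filter fun v => ∀ i, R v (t i))
    (𝒴.filter fun Y => Y ⊆ A.filter fun v => ∀ i, R v (t i))
    (fun Y hY => by
      have hYa : Y.card = a := (mem_powersetCard.mp (mem_filter.mp (mem_filter.mp hY).1).1).2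
      exact Finset.card_pos.mp (by omega))
  refine ⟨A₄, hA₄.trans (filter_subset _ _), le_trans ht ?_, ?_⟩
  · have := (Nat.cast_le (α := ℝ)).mpr hcard
    push_cast at this
    linarith
  · intro Y hY hYa
    by_contra hlt
    rw [not_le] at hlt
    refine hnot Y ?_ hY
    rw [mem_filter]
    refine ⟨?_, hY.trans hA₄⟩
    rw [h𝒴, mem_filter, mem_powersetCard]
    exact ⟨⟨(hY.trans hA₄).trans (filter_subset _ _), hYa⟩, hlt⟩

/-! ## Numerical estimates -/

/-- `C(m, a) ≤ 256 ^ a` whenever `m ≤ 81 a` (from `C(m,a) ≤ m^a / a!` and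
`a^a / a! ≤ e^a ≤ 3^a`). -/
theorem choose_le_of_le_mul {m a : ℕ} (hm : m ≤ 81 * a) : (m.choose a : ℝ) ≤ 256 ^ a := by
  have h1 : (m.choose a : ℝ) ≤ (m : ℝ) ^ a / (a.factorial : ℝ) := Nat.choose_le_pow_div a m
  have h2 : (a : ℝ) ^ a / (a.factorial : ℝ) ≤ Real.exp a :=
    Real.pow_div_factorial_le_exp _ (Nat.cast_nonneg _) a
  have h3 : Real.exp a ≤ 3 ^ a := by
    rw [← Real.exp_one_pow]
    exact pow_le_pow_left₀ (Real.exp_pos _).le (Real.exp_one_lt_d9.le.trans (by norm_num)) a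
  calc (m.choose a : ℝ) ≤ (m : ℝ) ^ a / (a.factorial : ℝ) := h1
    _ ≤ (81 * a : ℝ) ^ a / (a.factorial : ℝ) := by
        gcongr
        exact_mod_cast hm
    _ = 81 ^ a * ((a : ℝ) ^ a / (a.factorial : ℝ)) := by rw [mul_pow]; ring
    _ ≤ 81 ^ a * Real.exp a := by gcongr
    _ ≤ 81 ^ a * 3 ^ a := by gcongr
    _ = 243 ^ a := by rw [← mul_pow]; norm_num
    _ ≤ 256 ^ a := pow_le_pow_left₀ (by norm_num) (by norm_num) a

/-- `2 ^ (-4δ) ≤ 1 - δ` for `0 ≤ δ ≤ 1/2` (from `e^{2δ} ≥ 1 + 2δ` and `log 2 ≥ 1/2`). -/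
theorem two_rpow_neg_le_one_sub {δ : ℝ} (h0 : 0 ≤ δ) (h1 : δ ≤ 1 / 2) :
    (2 : ℝ) ^ (-(4 * δ)) ≤ 1 - δ := by
  have hlog : (1 : ℝ) / 2 < Real.log 2 := by linarith [Real.log_two_gt_d9]
  have hexp : 2 * δ + 1 ≤ Real.exp (2 * δ) := Real.add_one_le_exp _
  have hge : 1 + 2 * δ ≤ (2 : ℝ) ^ (4 * δ) := by
    rw [Real.rpow_def_of_pos two_pos]
    calc 1 + 2 * δ ≤ Real.exp (2 * δ) := by linarith
      _ ≤ Real.exp (Real.log 2 * (4 * δ)) := Real.exp_le_exp.mpr (by nlinarith)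
  have hpos : (0 : ℝ) < (2 : ℝ) ^ (4 * δ) := Real.rpow_pos_of_pos two_pos _
  have h1' : 0 ≤ 1 - δ := by linarith
  rw [Real.rpow_neg two_pos.le, ← one_div, div_le_iff₀ hpos]
  nlinarith [mul_le_mul_of_nonneg_left hge h1']

/-- The Erdős–Szekeres threshold: `C(k+a-2, k-1) ≤ 256 ^ a` when `k ≤ 80 a`. -/
theorem es_choose_le {k a : ℕ} (hk1 : 1 ≤ k) (ha1 : 1 ≤ a) (hk : k ≤ 80 * a) :
    (((k + a - 2).choose (k - 1) : ℕ) : ℝ) ≤ 256 ^ a := by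
  obtain ⟨p, rfl⟩ : ∃ p, k = p + 1 := ⟨k - 1, by omega⟩
  obtain ⟨q, rfl⟩ : ∃ q, a = q + 1 := ⟨a - 1, by omega⟩
  have e1 : p + 1 + (q + 1) - 2 = p + q := by omega
  have e2 : p + 1 - 1 = p := by omega
  rw [e1, e2]
  have hmono : (p + q).choose p ≤ (p + q + 1).choose (q + 1) := by
    rw [Nat.choose_symm_add, Nat.choose_succ_succ]
    exact Nat.le_add_right _ _
  calc (((p + q).choose p : ℕ) : ℝ) ≤ (((p + q + 1).choose (q + 1) : ℕ) : ℝ) := by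
        exact_mod_cast hmono
    _ ≤ 256 ^ (q + 1) := choose_le_of_le_mul (by omega)

/-- The "`n` large" arithmetic of the DRC step, in terms of `L = log₂ n ≥ 60`: with
`a = ⌈L/40⌉`, `h = ⌈a/κ'⌉`, `k < 2L + 1`, `2^{L/2} ≤ s ≤ N = 2^L`, the Erdős–Szekeres threshold
`C(k+a-2, k-1)` is at most `s (1 - κ'/4)^h - C(s, a) (N^{-κ'})^h`. -/
theorem drc_numerics {κ' L : ℝ} (hκ'0 : 0 < κ') (hκ'1 : κ' ≤ 1) (hL : 60 ≤ L) {k a h s N : ℕ}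
    (hk1 : 1 ≤ k) (hk : (k : ℝ) < 2 * L + 1) (ha : a = ⌈L / 40⌉₊) (hh : h = ⌈(a : ℝ) / κ'⌉₊)
    (hs : (2 : ℝ) ^ (L / 2) ≤ s) (hsN : s ≤ N) (hN : (N : ℝ) = 2 ^ L) :
    (((k + a - 2).choose (k - 1) : ℕ) : ℝ) ≤
      s * (1 - κ' / 4) ^ h - (s.choose a : ℝ) * ((N : ℝ) ^ (-κ')) ^ h := by
  -- the parameters `a` and `h`
  have haL : L / 40 ≤ a := ha ▸ Nat.le_ceil _
  have haL' : (a : ℝ) < L / 40 + 1 := ha ▸ Nat.ceil_lt_add_one (by positivity)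
  have ha1 : 1 ≤ a := by exact_mod_cast (show (1 : ℝ) ≤ a by linarith)
  have hha : (a : ℝ) ≤ κ' * h := by
    have : (a : ℝ) / κ' ≤ h := hh ▸ Nat.le_ceil _
    rw [div_le_iff₀ hκ'0] at this
    linarith
  have hha' : κ' * h < a + 1 := by
    have : (h : ℝ) < a / κ' + 1 := hh ▸ Nat.ceil_lt_add_one (by positivity)
    have := mul_lt_mul_of_pos_left this hκ'0
    rw [mul_add, mul_div_cancel₀ _ hκ'0.ne', mul_one] at this
    linarith
  have hk80 : k ≤ 80 * a := by
    have : (k : ℝ) < 80 * a + 1 := by linarith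
    have : k < 80 * a + 1 := by exact_mod_cast this
    omega
  -- (1) the threshold is at most `2 ^ (L/5 + 8)`
  have h1 : (((k + a - 2).choose (k - 1) : ℕ) : ℝ) ≤ 2 ^ (L / 5 + 8) := by
    refine (es_choose_le hk1 ha1 hk80).trans ?_
    calc (256 : ℝ) ^ a = ((2 : ℝ) ^ (8 : ℝ)) ^ a := by norm_num
      _ = 2 ^ ((8 : ℝ) * a) := (Real.rpow_mul_natCast two_pos.le 8 a).symm
      _ ≤ 2 ^ (L / 5 + 8) := Real.rpow_le_rpow_of_exponent_le one_le_two (by linarith)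
  -- (2) the density loss `(1 - κ'/4)^h ≥ 2^{-(L/40 + 2)}`
  have h2 : (2 : ℝ) ^ (-(L / 40 + 2)) ≤ (1 - κ' / 4) ^ h := by
    have hstep : (2 : ℝ) ^ (-κ') ≤ 1 - κ' / 4 := by
      have := two_rpow_neg_le_one_sub (δ := κ' / 4) (by positivity) (by linarith)
      rwa [show 4 * (κ' / 4) = κ' by ring] at this
    calc (2 : ℝ) ^ (-(L / 40 + 2)) ≤ 2 ^ (-κ' * h) :=
          Real.rpow_le_rpow_of_exponent_le one_le_two (by linarith)
      _ = ((2 : ℝ) ^ (-κ')) ^ h := Real.rpow_mul_natCast two_pos.le _ _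
      _ ≤ (1 - κ' / 4) ^ h := pow_le_pow_left₀ (Real.rpow_nonneg two_pos.le _) hstep h
  -- (3) the bad sets cost at most `1`
  have h3 : (s.choose a : ℝ) * ((N : ℝ) ^ (-κ')) ^ h ≤ 1 := by
    have hc : (s.choose a : ℝ) ≤ (2 : ℝ) ^ (L * a) := by
      have : s.choose a ≤ N ^ a := (Nat.choose_le_pow s a).trans (Nat.pow_le_pow_left hsN a)
      calc (s.choose a : ℝ) ≤ ((N ^ a : ℕ) : ℝ) := by exact_mod_cast this
        _ = (2 : ℝ) ^ (L * a) := by rw [Nat.cast_pow, hN, Real.rpow_mul_natCast two_pos.le]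
    have he : ((N : ℝ) ^ (-κ')) ^ h = (2 : ℝ) ^ (L * (-κ') * h) := by
      rw [hN, Real.rpow_mul_natCast two_pos.le, Real.rpow_mul two_pos.le]
    calc (s.choose a : ℝ) * ((N : ℝ) ^ (-κ')) ^ h
        ≤ (2 : ℝ) ^ (L * a) * (2 : ℝ) ^ (L * (-κ') * h) := by rw [he]; gcongr
      _ = 2 ^ (L * (a - κ' * h)) := by rw [← Real.rpow_add two_pos]; ring_nf
      _ ≤ 1 := Real.rpow_le_one_of_one_le_of_nonpos one_le_two
          (mul_nonpos_of_nonneg_of_nonpos (by linarith) (by linarith))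
  -- (4) assemble
  have h4 : (2 : ℝ) ^ (L / 5 + 8) + 1 ≤ 2 ^ (L / 2) * 2 ^ (-(L / 40 + 2)) := by
    have e1 : (2 : ℝ) ^ (L / 2) * 2 ^ (-(L / 40 + 2)) = 2 ^ (L / 5 + 9 + (11 * L / 40 - 11)) := by
      rw [← Real.rpow_add two_pos]; ring_nf
    have e2 : (2 : ℝ) ^ (L / 5 + 9) = 2 ^ (L / 5 + 8) * 2 := by
      rw [show L / 5 + 9 = (L / 5 + 8) + 1 by ring, Real.rpow_add two_pos, Real.rpow_one]
    have i1 : (1 : ℝ) ≤ 2 ^ (L / 5 + 8) := Real.one_le_rpow one_le_two (by linarith)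
    have i2 : (2 : ℝ) ^ (L / 5 + 9) ≤ 2 ^ (L / 5 + 9 + (11 * L / 40 - 11)) :=
      Real.rpow_le_rpow_of_exponent_le one_le_two (by linarith)
    rw [e1]
    linarith
  have h5 : (2 : ℝ) ^ (L / 2) * 2 ^ (-(L / 40 + 2)) ≤ s * (1 - κ' / 4) ^ h :=
    mul_le_mul hs h2 (Real.rpow_nonneg two_pos.le _) (Nat.cast_nonneg _)
  linarith

/-! ## The DRC step -/

/-- **DRC step** (stub `stub_drcStep`, line `box-dag-self-gadget-lifting`, crux `stmt-PneNP-9816`):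
for every `κ > 0` there are `δ > 0` and `n₀` such that for `n ≥ n₀`, every graph `H` on `Fin n`
with no clique of size `⌈log₂ n²⌉`, every `A` with `|A| ≥ √n` all of whose vertices have at most
`δ|B|` neighbours in `B`, contains an independent set `J ⊆ A`, `|J| ≥ log₂ n / 40`, whose common
non-neighbourhood in `B` has at least `|B| n^{-κ}` elements.  Constants: `δ = min κ 1 / 4`,
`n₀ = 2^60`; `|J| = ⌈log₂ n / 40⌉`. -/
theorem stub_drcStep :
    ∀ κ : ℝ, 0 < κ → ∃ δ : ℝ, 0 < δ ∧ ∃ n₀ : ℕ, ∀ n ≥ n₀, ∀ (H : SimpleGraph (Fin n)) [DecidableRel H.Adj],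
      H.CliqueFree (Nat.clog 2 (n ^ 2)) →
      ∀ A B : Finset (Fin n), (n : ℝ) ^ ((1 : ℝ) / 2) ≤ A.card →
        (∀ v ∈ A, ((B.filter fun b => H.Adj v b).card : ℝ) ≤ δ * B.card) →
        ∃ J ⊆ A, Hᶜ.IsClique (J : Set (Fin n)) ∧ Real.logb 2 n / 40 ≤ J.card ∧
          (B.card : ℝ) * (n : ℝ) ^ (-κ) ≤ ((B.filter fun b => ∀ v ∈ J, ¬ H.Adj v b).card : ℝ) := by
  intro κ hκ
  obtain ⟨κ', hκ'⟩ : ∃ κ' : ℝ, κ' = min κ 1 := ⟨_, rfl⟩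
  have hκ'pos : 0 < κ' := hκ' ▸ lt_min hκ one_pos
  have hκ'le1 : κ' ≤ 1 := hκ' ▸ min_le_right _ _
  have hκ'leκ : κ' ≤ κ := hκ' ▸ min_le_left _ _
  refine ⟨κ' / 4, by positivity, 2 ^ 60, ?_⟩
  intro n hn H _ hfree A B hA hdeg
  -- `n` as a power of two
  have hn1 : 1 ≤ n := le_trans Nat.one_le_two_pow hn
  have hnpos : (0 : ℝ) < n := by exact_mod_cast hn1
  have hn1' : (1 : ℝ) ≤ n := by exact_mod_cast hn1
  set L := Real.logb 2 n with hL
  have hnL : (n : ℝ) = 2 ^ L := (Real.rpow_logb two_pos (by norm_num) hnpos).symm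
  have hL60 : 60 ≤ L := by
    have : (2 : ℝ) ^ ((60 : ℕ) : ℝ) ≤ 2 ^ L := by
      rw [← hnL, Real.rpow_natCast]
      exact_mod_cast hn
    have := (Real.rpow_le_rpow_left_iff one_lt_two).mp this
    exact_mod_cast this
  -- the clique bound `k`
  generalize hk : Nat.clog 2 (n ^ 2) = k at hfree
  have hn2 : 1 < n ^ 2 := by nlinarith
  have hk1 : 1 ≤ k := hk ▸ Nat.clog_pos one_lt_two hn2
  have hkL : (k : ℝ) < 2 * L + 1 := by
    have hlt : 2 ^ (k - 1) < n ^ 2 := by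
      have := Nat.pow_pred_clog_lt_self one_lt_two hn2
      rwa [hk, Nat.pred_eq_sub_one] at this
    have hlt' : (2 : ℝ) ^ (((k - 1 : ℕ)) : ℝ) < 2 ^ (2 * L) := by
      rw [Real.rpow_natCast]
      calc (2 : ℝ) ^ (k - 1) = ((2 ^ (k - 1) : ℕ) : ℝ) := by push_cast; rfl
        _ < ((n ^ 2 : ℕ) : ℝ) := by exact_mod_cast hlt
        _ = 2 ^ (2 * L) := by rw [Nat.cast_pow, hnL, ← Real.rpow_mul_natCast two_pos.le]; ring_nf
    have := (Real.rpow_lt_rpow_left_iff one_lt_two).mp hlt'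
    rw [Nat.cast_sub hk1, Nat.cast_one] at this
    linarith
  -- the parameters `a`, `h`
  obtain ⟨a, ha⟩ : ∃ a : ℕ, a = ⌈L / 40⌉₊ := ⟨_, rfl⟩
  obtain ⟨h, hh⟩ : ∃ h : ℕ, h = ⌈(a : ℝ) / κ'⌉₊ := ⟨_, rfl⟩
  have haL : L / 40 ≤ a := ha ▸ Nat.le_ceil _
  have ha1 : 1 ≤ a := by exact_mod_cast (show (1 : ℝ) ≤ a by linarith)
  -- numerics
  have hAn : A.card ≤ n := by simpa using A.card_le_univ
  have hA' : (2 : ℝ) ^ (L / 2) ≤ A.card := by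
    calc (2 : ℝ) ^ (L / 2) = (n : ℝ) ^ ((1 : ℝ) / 2) := by
          rw [hnL, ← Real.rpow_mul two_pos.le]; ring_nf
      _ ≤ A.card := hA
  have hnum := drc_numerics hκ'pos hκ'le1 hL60 hk1 hkL ha hh hA' hAn hnL
  -- the DRC step proper
  obtain ⟨A₄, hA₄A, hA₄card, hA₄good⟩ : ∃ A₄ ⊆ A,
      (((k + a - 2).choose (k - 1) : ℕ) : ℝ) ≤ A₄.card ∧
      ∀ Y ⊆ A₄, Y.card = a →
        (B.card : ℝ) * (n : ℝ) ^ (-κ') ≤ ((B.filter fun b => ∀ v ∈ Y, ¬ H.Adj v b).card : ℝ) := by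
    rcases B.eq_empty_or_nonempty with rfl | hB
    · refine ⟨A, Subset.rfl, hnum.trans ?_, fun Y _ _ => by simp⟩
      have i1 : (1 - κ' / 4) ^ h ≤ 1 := pow_le_one₀ (by linarith) (by linarith)
      have i2 : 0 ≤ (A.card.choose a : ℝ) * ((n : ℝ) ^ (-κ')) ^ h := by positivity
      nlinarith [Nat.cast_nonneg (α := ℝ) A.card]
    · have hdeg' : ∀ v ∈ A, (1 - κ' / 4) * B.card ≤ ((B.filter fun b => ¬ H.Adj v b).card : ℝ) := by
        intro v hv
        have h1 := hdeg v hv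
        have h2 : ((B.filter fun b => H.Adj v b).card : ℝ) +
            ((B.filter fun b => ¬ H.Adj v b).card : ℝ) = B.card := by
          exact_mod_cast Finset.card_filter_add_card_filter_not (s := B) (fun b => H.Adj v b)
        linarith
      obtain ⟨A₄, h1, h2, h3⟩ := exists_good_subset A B (fun v b => ¬ H.Adj v b) h a ha1
        (κ' / 4) ((n : ℝ) ^ (-κ')) (by linarith) (Real.rpow_nonneg hnpos.le _) hB hdeg'
      refine ⟨A₄, h1, hnum.trans h2, fun Y hY hYa => (h3 Y hY hYa).trans_eq ?_⟩
      congr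
  -- Erdős–Szekeres inside `A₄`
  obtain ⟨J, hJA₄, hJ⟩ : ∃ J ⊆ A₄, Hᶜ.IsNClique a J := by
    obtain ⟨p, rfl⟩ : ∃ p, k = p + 1 := ⟨k - 1, by omega⟩
    obtain ⟨q, rfl⟩ : ∃ q, a = q + 1 := ⟨a - 1, by omega⟩
    have hc : (p + q).choose p ≤ A₄.card := by
      have e1 : p + 1 + (q + 1) - 2 = p + q := by omega
      have e2 : p + 1 - 1 = p := by omega
      rw [e1, e2] at hA₄card
      exact_mod_cast hA₄card
    rcases Literature.Combinatorics.SimpleGraph.exists_clique_or_indep_of_choose_le_card H (p + q)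
        p q rfl A₄ hc with ⟨t, -, ht⟩ | ⟨t, htA, ht⟩
    · exact absurd hfree ht.not_cliqueFree
    · exact ⟨t, htA, ht⟩
  refine ⟨J, hJA₄.trans hA₄A, hJ.isClique, ?_, ?_⟩
  · rw [hJ.card_eq]; exact haL
  · calc (B.card : ℝ) * (n : ℝ) ^ (-κ) ≤ B.card * (n : ℝ) ^ (-κ') :=
        mul_le_mul_of_nonneg_left (Real.rpow_le_rpow_of_exponent_le hn1' (by linarith))
          (Nat.cast_nonneg _)
      _ ≤ _ := hA₄good J hJA₄ hJ.card_eq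

end Summit.PneNP.PneNP.Theorems.RamseyUncertifiableResolutionUncertainty
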